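import Literature.AlgebraicGeometry.AbelianSchemes.AbelianSchemeKOfL
import Literature.AlgebraicGeometry.AbelianSchemes.AbelianSchemeOverLevelBaseChange
import Literature.AlgebraicGeometry.AbelianSchemes.FibreHomPointsOfFibrePoints
import Literature.AlgebraicGeometry.AbelianVarieties.TheoremOfTheSquareCechPic
import Literature.AlgebraicGeometry.Motives.AbelianVarietyWeilPairingRadical
import Literature.AlgebraicGeometry.Modules.CechPicOfLocalRing
import Literature.AlgebraicGeometry.Modules.UnitCocyclePresented
import HarnessLib

/-!
# `K(L)` on geometric fibres: `K(L)(Ω)` over a geometric point `s` is Mumford's `K(Θ)` of the fibre `A_s`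

Layer `Literature/AlgebraicGeometry/AbelianSchemes`, namespace `Literature.AlgebraicGeometry.AbelianSchemes.AbelianSchemeOver`.
THEOREMS ONLY (no definition, no named fact, no instance, no `sorry`).  Cell `hodgecm-mathlib` (D-0151), (F) road first hand
(h5) `K(L)` (director s207; partner file of ★ `AbelianSchemeKOfL`, B-p08 (g11)): the functor of points `K(L)` of
[MumfordAV1970] §13 / [MumfordFogartyKirwan1994] App. 7B (`A.MemKOfL L u`, «`(1_A × u)^*Λ(L)` is trivial») READ AT A
GEOMETRIC POINT `s : Spec Ω → S`: for an `Ω`-point `P` of the fibre `A_s` and a Cartier divisor `Θ` on `A_s` with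
`[L|_{A_s}] = [Θ]`, the point `u_P : Spec Ω → A` lies in `K(L)` iff `P ∈ K(Θ) = {P ; t_P^*Θ ∼ Θ}` (★ `AbelianVariety.KTheta`)
— [MumfordAV1970] §13 «the `k`-valued points of `K(L)` are the `K(L)` of §6»; hence `K(L)(Ω)` is FINITE when `Θ` is ample
([MumfordAV1970] §6 Application 1, ★ `finite_KTheta`) and is killed by its order.

* §1 `translation_left_comp_fst` — the translation `t_P` of the fibre ABELIAN VARIETY `A_s` over the ambient group law:
  `t_P ≫ (A_s → A) = (1_A × u_P) ≫ m` (transported group structure, ★ `mul_baseChange_left_comp_fst`);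
  `translate_homMk_left` — B-p08's relative translation ★ `translate u_P` of `A ×_S Spec Ω` IS `t_P` on underlying schemes;
* §2 `pullback_whiskerLeft_mumfordClass_homMk` — `(1_A × u_P)^*[Λ]c = t_P^*(ι_s^*c) · (ι_s^*c)⁻¹` (the third factor of ★
  `pullback_whiskerLeft_mumfordClass` dies in `Ȟ¹(Spec Ω, 𝒪^×) = 1`); `memKOfL_homMk_iff_phiPic_eq_one`;
* §3 **`memKOfL_homMk_iff_mem_KTheta`** — `u_P ∈ K(L)(Ω) ↔ P ∈ K(Θ)` for `ι_s^*[L] = [Θ]`; `memKOfL_iff_exists_mem_KTheta` for an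
  arbitrary `Ω`-point `u` of `A` over `s`;
* §4 **`finite_setOf_memKOfL`**, `finite_setOf_memKOfL_fibrePoints` (`Θ` ample, `Ω` algebraically closed) and
  `pow_natCard_KTheta_eq_one_of_memKOfL` (`P^{#K(Θ)} = 1`).

HC_CM is proved only modulo the 7 printed citations until rung 0 closes; nothing here is about HC.

## References
* [MumfordAV1970] D. Mumford, *Abelian Varieties* (1970), §13 (p. 123: definition of `K(L)`), §6 Application 1 (p. 60), §8 (p. 74).
* [MumfordFogartyKirwan1994] D. Mumford, J. Fogarty, F. Kirwan, *Geometric Invariant Theory*, 3rd ed. (1994), Ch. 6 §2 Definition 6.2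
  (p. 120); App. 7B, Definition of `H(L)` (p. 240).
* [Lange2023AbelianVarietiesComplex] H. Lange, *Abelian Varieties over the Complex Numbers* (2023), §1.4.2 (`φ_L(x) = t_x^*L ⊗ L⁻¹`).
-/

noncomputable section

-- `Scheme.Modules` / `SheafOfModules` are not reducible; `(A.X ⊗ Over.mk s).left = pullback A.X.hom s` holds by `rfl` only.
set_option backward.isDefEq.respectTransparency false

universe u

open CategoryTheory CategoryTheory.Limits AlgebraicGeometry MonoidalCategory CartesianMonoidalCategory
open scoped MonObj

namespace Literature.AlgebraicGeometry.AbelianSchemes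

namespace AbelianSchemeOver

open Literature.AlgebraicGeometry.Motives Literature.AlgebraicGeometry.AbelianVarieties Literature.AlgebraicGeometry.Modules

variable {S : Scheme.{u}} (A : AbelianSchemeOver S) {Ω : Type u} [Field Ω] (s : Spec (.of Ω) ⟶ S)

/-! ## §1 The translation of the fibre abelian variety over the ambient group law -/

/-- **`t_P ≫ (A_s → A) = (1_A × u_P) ≫ m`**: the translation by an `Ω`-point `P` of the fibre ABELIAN VARIETY `A_s`
(transported group structure, ★ `AbelianSchemeOver.fibre`) followed by the inclusion `A_s → A` is the `DualPair` slice map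
`1_A × u_P : A_s → A ×_S A` (★ `baseChangeToProd`, `u_P : Spec Ω → A` the point under `P`) followed by the group law
(`t_P = 1 · P` in the commutative hom-group, ★ `mul_baseChange_left_comp_fst`). [cite: MumfordFogartyKirwan1994, Ch. 6 §1 Definition 6.1 (p. 115)]
[cite: MumfordAV1970, §13 (p. 123)] -/
theorem translation_left_comp_fst (P : (A.fibre s).toAbelianVariety.Points Ω) :
    ((A.fibre s).toAbelianVariety.translation P).left ≫ pullback.fst A.X.hom s =
      A.baseChangeToProd A s (A.fibrePointToLeft s P) (A.fibrePointToLeft_comp_hom s P) ≫ μ[A.X].left := by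
  have w : pullback.fst A.X.hom s ≫ A.X.hom = (A.baseChange s).X.hom ≫ s := pullback.condition
  have hμ := A.mul_baseChange_left_comp_fst s w
  -- `t_P = 1 · P_const` in the commutative hom-monoid of the fibre
  have ht : (A.fibre s).toAbelianVariety.translation P =
      (𝟙 (A.fibre s).toAbelianVariety.X) * (toSpecOver (A.fibre s).toAbelianVariety.X ≫ P) := by
    rw [AbelianVariety.translation, mul_comm]
  have wc : (𝟙 ((A.baseChange s).X.left) : _ ⟶ _) ≫ (A.baseChange s).X.hom =
      ((A.baseChange s).X.hom ≫ (P.left : Spec (.of Ω) ⟶ (A.baseChange s).X.left)) ≫ (A.baseChange s).X.hom := by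
    have h := A.fibrePoint_left_comp_snd s P
    change 𝟙 _ ≫ pullback.snd A.X.hom s =
      (pullback.snd A.X.hom s ≫ (P.left : Spec (.of Ω) ⟶ pullback A.X.hom s)) ≫ pullback.snd A.X.hom s
    rw [Category.id_comp, Category.assoc]
    exact (((pullback.snd A.X.hom s) ≫= h).trans (Category.comp_id _)).symm
  have h1 : ((A.fibre s).toAbelianVariety.translation P).left =
      pullback.lift (f := (A.baseChange s).X.hom) (g := (A.baseChange s).X.hom) (𝟙 _)
        ((A.baseChange s).X.hom ≫ (P.left : Spec (.of Ω) ⟶ (A.baseChange s).X.left)) wc ≫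
        μ[(A.baseChange s).X].left := by
    rw [ht]; rfl
  have key : pullback.lift (f := (A.baseChange s).X.hom) (g := (A.baseChange s).X.hom) (𝟙 _)
        ((A.baseChange s).X.hom ≫ (P.left : Spec (.of Ω) ⟶ (A.baseChange s).X.left)) wc ≫
      pullback.map (A.baseChange s).X.hom (A.baseChange s).X.hom A.X.hom A.X.hom
          (pullback.fst A.X.hom s) (pullback.fst A.X.hom s) s w.symm w.symm =
      A.baseChangeToProd A s (A.fibrePointToLeft s P) (A.fibrePointToLeft_comp_hom s P) := by
    apply pullback.hom_ext
    · simp only [Category.assoc, pullback.lift_fst, pullback.lift_fst_assoc, Category.id_comp]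
      exact (A.baseChangeToProd_fst A s (A.fibrePointToLeft s P) (A.fibrePointToLeft_comp_hom s P)).symm
    · simp only [Category.assoc, pullback.lift_snd, pullback.lift_snd_assoc]
      exact (A.baseChangeToProd_snd A s (A.fibrePointToLeft s P) (A.fibrePointToLeft_comp_hom s P)).symm
  exact (eq_whisker h1 _).trans ((Category.assoc _ _ _).trans ((whisker_eq _ hμ).trans
    ((Category.assoc _ _ _).symm.trans (eq_whisker key _))))

/-- **The relative translation IS `t_P` on the fibre**: for the `S`-point `u_P : Spec Ω → A` over `s` underlying `P`, the
underlying scheme morphism of ★ `A.translate u_P : A ×_S Spec Ω → A ×_S Spec Ω` (`(a, t) ↦ (a + u_P(t), t)`) is the translation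
`t_P` of the abelian variety `A_s` (same two components: `(1 × u_P) ≫ m` and the projection to `Spec Ω`).
[cite: MumfordFogartyKirwan1994, App. 7B, Definition of H(L) (p. 240)] [cite: MumfordAV1970, §13 (p. 123)] -/
theorem translate_homMk_left (P : (A.fibre s).toAbelianVariety.Points Ω) :
    (A.translate (Over.homMk (A.fibrePointToLeft s P) (A.fibrePointToLeft_comp_hom s P) : Over.mk s ⟶ A.X)).left =
      ((A.fibre s).toAbelianVariety.translation P).left := by
  apply pullback.hom_ext
  · -- first components: `translate u ≫ p_A = p_A · (p ≫ u) = (1 × u) ≫ m = t_P ≫ (A_s → A)`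
    have s2 := congrArg CommaMorphism.left
      (A.translate_fst (Over.homMk (A.fibrePointToLeft s P) (A.fibrePointToLeft_comp_hom s P) : Over.mk s ⟶ A.X))
    have s3 := congrArg CommaMorphism.left
      (A.whiskerLeft_comp_mul_eq (Over.homMk (A.fibrePointToLeft s P) (A.fibrePointToLeft_comp_hom s P) : Over.mk s ⟶ A.X))
    have s5 := A.baseChangeToProd_eq_whiskerLeft_left A
      (Over.homMk (A.fibrePointToLeft s P) (A.fibrePointToLeft_comp_hom s P) : Over.mk s ⟶ A.X)
    have s6 := A.translation_left_comp_fst s P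
    have e5 := congrArg (fun f => f ≫ μ[A.X].left) s5.symm
    exact s2.trans (s3.symm.trans (e5.trans s6.symm))
  · -- second components: both lie over `Spec Ω`
    have s2 := congrArg CommaMorphism.left
      (A.translate_snd (Over.homMk (A.fibrePointToLeft s P) (A.fibrePointToLeft_comp_hom s P) : Over.mk s ⟶ A.X))
    exact s2.trans (Over.w ((A.fibre s).toAbelianVariety.translation P)).symm

/-! ## §2 The class `(1_A × u_P)^*[Λ(L)]` at a geometric point -/

/-- **`(1_A × u_P)^*[Λ]c = t_P^*(ι_s^*c) · (ι_s^*c)⁻¹` in `Ȟ¹(A_s, 𝒪^×)`** for a class `c ∈ Ȟ¹(A, 𝒪^×)` and an `Ω`-point `P` of the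
fibre (`ι_s : A_s → A` the inclusion): of the three factors of ★ `pullback_whiskerLeft_mumfordClass`, `[(1 × u_P) ≫ m]^*c =
t_P^*(ι_s^*c)` (§1), `[p_A]^*c = ι_s^*c`, and `[p ≫ u_P]^*c = 1` because it is pulled back through `Ȟ¹(Spec Ω, 𝒪^×) = 1`
(★ `CechPic.eq_one_of_isLocalRing`).  This is `φ_{ι_s^*c}(P)` of ★ `phiPic` ([Lange2023] §1.4.2).
[cite: MumfordFogartyKirwan1994, Ch. 6 §2 Definition 6.2 (p. 120)] [cite: MumfordAV1970, §13 (p. 123)] -/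
theorem pullback_whiskerLeft_mumfordClass_homMk (c : CechPic A.left) (P : (A.fibre s).toAbelianVariety.Points Ω) :
    CechPic.pullback (A.X ◁ (Over.homMk (A.fibrePointToLeft s P) (A.fibrePointToLeft_comp_hom s P) : Over.mk s ⟶ A.X)).left
        (A.mumfordClass c) =
      CechPic.pullback (X := (A.X ⊗ Over.mk s).left) (Y := (A.X ⊗ Over.mk s).left)
          ((A.fibre s).toAbelianVariety.translation P).left (CechPic.pullback (fst A.X (Over.mk s)).left c) *
        (CechPic.pullback (fst A.X (Over.mk s)).left c)⁻¹ := by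
  have e3 : CechPic.pullback (snd A.X (Over.mk s) ≫
      (Over.homMk (A.fibrePointToLeft s P) (A.fibrePointToLeft_comp_hom s P) : Over.mk s ⟶ A.X)).left c = 1 := by
    rw [Over.comp_left, CechPic.pullback_comp,
      CechPic.eq_one_of_isLocalRing (CechPic.pullback
        (Over.homMk (A.fibrePointToLeft s P) (A.fibrePointToLeft_comp_hom s P) : Over.mk s ⟶ A.X).left c), map_one]
  have e1 : CechPic.pullback ((A.X ◁ (Over.homMk (A.fibrePointToLeft s P) (A.fibrePointToLeft_comp_hom s P) :
      Over.mk s ⟶ A.X)) ≫ μ[A.X]).left c =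
      CechPic.pullback (X := (A.X ⊗ Over.mk s).left) (Y := (A.X ⊗ Over.mk s).left)
        ((A.fibre s).toAbelianVariety.translation P).left (CechPic.pullback (fst A.X (Over.mk s)).left c) := by
    rw [A.whiskerLeft_comp_mul_eq, ← A.translate_fst, Over.comp_left, CechPic.pullback_comp]
    exact congrArg (fun f : (A.X ⊗ Over.mk s).left ⟶ (A.X ⊗ Over.mk s).left =>
      CechPic.pullback f (CechPic.pullback (fst A.X (Over.mk s)).left c)) (A.translate_homMk_left s P)
  rw [A.pullback_whiskerLeft_mumfordClass, e3, inv_one, mul_one, e1]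

/-- **`u_P ∈ K(L)(Ω) ↔ φ_{[L|_{A_s}]}(P) = 1`**: membership of the point under `P` in `K(L)` (★ `MemKOfL`, print's definition
via the Mumford bundle) is the vanishing of `φ_c(P) = t_P^*c · c⁻¹` (★ `phiPic`) for the class `c = ι_s^*[L]` of `L` on the fibre.
[cite: MumfordAV1970, §13 (p. 123)] [cite: Lange2023AbelianVarietiesComplex, §1.4.2] -/
theorem memKOfL_homMk_iff_phiPic_eq_one {L : A.left.Modules} (hL : HasRank L 1)
    (P : (A.fibre s).toAbelianVariety.Points Ω) :
    A.MemKOfL L (Over.homMk (A.fibrePointToLeft s P) (A.fibrePointToLeft_comp_hom s P) : Over.mk s ⟶ A.X) ↔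
      phiPic (A.fibre s).toAbelianVariety
        (CechPic.pullback (X := (A.fibre s).toAbelianVariety.X.left) (pullback.fst A.X.hom s)
          (detClass (HasRank.isFiniteLocallyFree' hL))) P = 1 := by
  rw [A.memKOfL_iff_mumfordClass hL, A.pullback_whiskerLeft_mumfordClass_homMk, mul_inv_eq_one, phiPic_eq_one_iff]
  exact Iff.rfl

/-! ## §3 `K(L)(Ω) = K(Θ)` for `[L|_{A_s}] = [Θ]` -/

/-- **`u_P ∈ K(L)(Ω) ↔ P ∈ K(Θ)`** at a geometric point `s`, for a rank-one `L` on `A` and a Cartier divisor `Θ` on the fibre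
`A_s` with `ι_s^*[L] = [Θ]` in `Ȟ¹(A_s, 𝒪^×)` — [MumfordAV1970] §13: «the `k`-valued points of `K(L)` form the group `K(L)` of
§6», here `K(Θ) = {P ; t_P^*Θ ∼ Θ}` = ★ `AbelianVariety.KTheta` (★ `phiPic_cechClass_eq_one_iff_mem_KTheta`).
[cite: MumfordAV1970, §13 (p. 123) and §6 Definition (p. 60)] [cite: MumfordFogartyKirwan1994, App. 7B, Definition of H(L) (p. 240)] -/
theorem memKOfL_homMk_iff_mem_KTheta {L : A.left.Modules} (hL : HasRank L 1) (P : (A.fibre s).toAbelianVariety.Points Ω)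
    {Θ : CartierDivisor (A.fibre s).toAbelianVariety.X.left}
    (hLΘ : CechPic.pullback (X := (A.fibre s).toAbelianVariety.X.left) (pullback.fst A.X.hom s)
      (detClass (HasRank.isFiniteLocallyFree' hL)) = Θ.cechClass) :
    A.MemKOfL L (Over.homMk (A.fibrePointToLeft s P) (A.fibrePointToLeft_comp_hom s P) : Over.mk s ⟶ A.X) ↔
      P ∈ (A.fibre s).toAbelianVariety.KTheta Θ := by
  rw [A.memKOfL_homMk_iff_phiPic_eq_one s hL, hLΘ, phiPic_cechClass_eq_one_iff_mem_KTheta]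

/-- The module form of the hypothesis «`L|_{A_s} ≅ 𝒪(Θ)`» gives the class form `ι_s^*[L] = [Θ]`
(★ `detClass_lineBundle_toUnitCocycle`, ★ `detClass_eq_of_iso`). [cite: GortzWedhorn2020, Ch. 11 (11.9) and Cor. 11.30] -/
theorem cechPic_pullback_fst_detClass_eq_of_iso {L : A.left.Modules} (hL : HasRank L 1)
    {Θ : CartierDivisor (A.fibre s).toAbelianVariety.X.left}
    (e : (Scheme.Modules.pullback (X := (A.fibre s).toAbelianVariety.X.left) (pullback.fst A.X.hom s)).obj L ≅
      A.lineBundleOfDivisor s Θ) :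
    CechPic.pullback (X := (A.fibre s).toAbelianVariety.X.left) (pullback.fst A.X.hom s)
      (detClass (HasRank.isFiniteLocallyFree' hL)) = Θ.cechClass := by
  rw [← detClass_pullback _ (HasRank.isFiniteLocallyFree' hL), ← detClass_lineBundle_toUnitCocycle Θ]
  exact detClass_eq_of_iso e _ _

/-- **`u ∈ K(L)(Ω) ↔ P ∈ K(Θ)` for ANY `Ω`-point `u` of `A` over `s` and its partner point `P` of the fibre** (`u.left = ` the
point under `P`; every `u` has a partner, ★ `exists_points_fibrePointToLeft_eq`). [cite: MumfordAV1970, §13 (p. 123)] -/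
theorem memKOfL_iff_mem_KTheta_of_fibrePointToLeft_eq {L : A.left.Modules} (hL : HasRank L 1) (u : A.FibrePoints s)
    (P : (A.fibre s).toAbelianVariety.Points Ω) (hP : A.fibrePointToLeft s P = u.left)
    {Θ : CartierDivisor (A.fibre s).toAbelianVariety.X.left}
    (hLΘ : CechPic.pullback (X := (A.fibre s).toAbelianVariety.X.left) (pullback.fst A.X.hom s)
      (detClass (HasRank.isFiniteLocallyFree' hL)) = Θ.cechClass) :
    A.MemKOfL L u ↔ P ∈ (A.fibre s).toAbelianVariety.KTheta Θ := by
  have hu : u = (Over.homMk (A.fibrePointToLeft s P) (A.fibrePointToLeft_comp_hom s P) : Over.mk s ⟶ A.X) :=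
    Over.OverMorphism.ext hP.symm
  rw [hu]
  exact A.memKOfL_homMk_iff_mem_KTheta s hL P hLΘ

/-! ## §4 Finiteness (`Θ` ample) and the order of `K(L)(Ω)` -/

/-- **`K(L)(Ω)` IS FINITE on the fibre over a geometric point when `[L|_{A_s}] = [Θ]` with `Θ` AMPLE** (`Ω` algebraically closed):
the set of `Ω`-points `P` of `A_s` with `u_P ∈ K(L)` is `K(Θ)`, finite by [MumfordAV1970] §6 Application 1 (★ `finite_KTheta`).
[cite: MumfordAV1970, §6 Application 1 (p. 60) and §13 (p. 123)] -/
theorem finite_setOf_memKOfL [IsAlgClosed Ω] {L : A.left.Modules} (hL : HasRank L 1)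
    {Θ : CartierDivisor (A.fibre s).toAbelianVariety.X.left} (hΘ : Θ.IsAmple)
    (hLΘ : CechPic.pullback (X := (A.fibre s).toAbelianVariety.X.left) (pullback.fst A.X.hom s)
      (detClass (HasRank.isFiniteLocallyFree' hL)) = Θ.cechClass) :
    {P : (A.fibre s).toAbelianVariety.Points Ω |
      A.MemKOfL L (Over.homMk (A.fibrePointToLeft s P) (A.fibrePointToLeft_comp_hom s P) : Over.mk s ⟶ A.X)}.Finite :=
  ((A.fibre s).toAbelianVariety.finite_KTheta hΘ).subset fun P hP => (A.memKOfL_homMk_iff_mem_KTheta s hL P hLΘ).1 hP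

/-- **The `Ω`-valued points of `K(L)` over `s` form a FINITE set** (`FibrePoints` currency: `S`-morphisms `Spec Ω → A` over `s`),
for `Θ` ample with `ι_s^*[L] = [Θ]` — every such point has a partner `Ω`-point of the fibre (★ `exists_points_fibrePointToLeft_eq`).
[cite: MumfordAV1970, §6 Application 1 (p. 60) and §13 (p. 123)] -/
theorem finite_setOf_memKOfL_fibrePoints [IsAlgClosed Ω] {L : A.left.Modules} (hL : HasRank L 1)
    {Θ : CartierDivisor (A.fibre s).toAbelianVariety.X.left} (hΘ : Θ.IsAmple)
    (hLΘ : CechPic.pullback (X := (A.fibre s).toAbelianVariety.X.left) (pullback.fst A.X.hom s)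
      (detClass (HasRank.isFiniteLocallyFree' hL)) = Θ.cechClass) :
    {u : A.FibrePoints s | A.MemKOfL L u}.Finite := by
  refine ((A.finite_setOf_memKOfL s hL hΘ hLΘ).image fun P : (A.fibre s).toAbelianVariety.Points Ω =>
    (Over.homMk (A.fibrePointToLeft s P) (A.fibrePointToLeft_comp_hom s P) : Over.mk s ⟶ A.X)).subset ?_
  intro u hu
  obtain ⟨P, hP⟩ := A.exists_points_fibrePointToLeft_eq s u
  have hu' : u = (Over.homMk (A.fibrePointToLeft s P) (A.fibrePointToLeft_comp_hom s P) : Over.mk s ⟶ A.X) :=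
    Over.OverMorphism.ext hP.symm
  refine ⟨P, ?_, hu'.symm⟩
  change A.MemKOfL L _
  rw [← hu']
  exact hu

/-- **`K(L)(Spec Ω)` — B-p08's subgroup ★ `kOfL` at the geometric point — IS FINITE** for `Θ` ample with `ι_s^*[L] = [Θ]`.
[cite: MumfordAV1970, §6 Application 1 (p. 60) and §13 (p. 123)] -/
theorem finite_kOfL_geomPoint [IsAlgClosed Ω] {L : A.left.Modules} (hL : HasRank L 1)
    (hε : CechPic.pullback A.unitSection (detClass (HasRank.isFiniteLocallyFree' hL)) = 1)
    {Θ : CartierDivisor (A.fibre s).toAbelianVariety.X.left} (hΘ : Θ.IsAmple)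
    (hLΘ : CechPic.pullback (X := (A.fibre s).toAbelianVariety.X.left) (pullback.fst A.X.hom s)
      (detClass (HasRank.isFiniteLocallyFree' hL)) = Θ.cechClass) :
    (A.kOfL L hL hε (Over.mk s) : Set (A.FibrePoints s)).Finite :=
  A.finite_setOf_memKOfL_fibrePoints s hL hΘ hLΘ

/-- **`K(L)(Ω)` is killed by the order of `K(Θ)`**: `P ^ #K(Θ) = 1` for `u_P ∈ K(L)` (Lagrange, ★ `pow_natCard_KTheta_eq_one`;
so `K(L)(Ω) ⊆ A_s[m]` with `m = #K(Θ)`, the input of the «`K(L)` inside the `m`-torsion» road).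
[cite: MumfordAV1970, §6 Application 1 (p. 60) and §13 (p. 123)] -/
theorem pow_natCard_KTheta_eq_one_of_memKOfL {L : A.left.Modules} (hL : HasRank L 1)
    {P : (A.fibre s).toAbelianVariety.Points Ω} {Θ : CartierDivisor (A.fibre s).toAbelianVariety.X.left}
    (hLΘ : CechPic.pullback (X := (A.fibre s).toAbelianVariety.X.left) (pullback.fst A.X.hom s)
      (detClass (HasRank.isFiniteLocallyFree' hL)) = Θ.cechClass)
    (hP : A.MemKOfL L (Over.homMk (A.fibrePointToLeft s P) (A.fibrePointToLeft_comp_hom s P) : Over.mk s ⟶ A.X)) :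
    P ^ Nat.card ((A.fibre s).toAbelianVariety.KTheta Θ) = 1 :=
  (A.fibre s).toAbelianVariety.pow_natCard_KTheta_eq_one ((A.memKOfL_homMk_iff_mem_KTheta s hL P hLΘ).1 hP)

end AbelianSchemeOver

end Literature.AlgebraicGeometry.AbelianSchemes

end
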